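import Literature.NumberTheory.QuadraticFields.ThreeTorsionMeanSquarefreeEuler
import Mathlib.Analysis.PSeries
import Mathlib.Analysis.Normed.Group.InfiniteSum
import HarnessLib

/-!
# The density of squarefree integers in an arbitrary residue class `c (mod L)`

The Euler product behind counting squarefree integers `x ≡ c (mod L)` for ARBITRARY `c`
(Taniguchi–Thorne 2013, Lemma 21: "a relatively straightforward generalization of Tenenbaum,
I.3.7, Thm 9"; their local factors `e(a, pᵏ)`): with `G_d = gcd(L, d²)`, the conditions
`x ≡ c (mod L)`, `d² ∣ x` are compatible iff `G_d ∣ c`, in which case they form one class modulo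
`lcm(L, d²) = L d²/G_d`; so the density is `(1/L) Σ_d μ(d) 𝟙_{G_d ∣ c} G_d/d²`, an Euler product
with local factor `e_p = 1 - 𝟙_{G_p ∣ c} G_p/p²` at `p ∣ L` (`= 1 - 𝟙_{p ∣ c}/p` if `p ∥ L`,
`= 1 - 𝟙_{p² ∣ c}` if `p² ∣ L`) and `1 - p⁻²` at `p ∤ L`. PROVED here (folklore):

* `hasSum_moebius_gcdWeight` —
  `Σ_d μ(d) 𝟙_{G_d ∣ c} G_d/d² = (6/π²) Π_{p ∣ L} e_p (1 - p⁻²)⁻¹`;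
* `abs_sub_sum_range_moebius_gcdWeight_le` — the tail beyond `d < k` is `≤ 2L/k`;
* `abs_sub_sum_range_moebius_coprime_div_sq_le` — the same for the coprime weight of
  `hasSum_moebius_coprime_div_sq` (`≤ 2/k`).

## References
* T. Taniguchi, F. Thorne, *Secondary terms in counting functions for cubic fields*, Duke Math. J.
  162 (2013), Lemma 21 [TaniguchiThorne2013].
* G. Tenenbaum, *Introduction to analytic and probabilistic number theory*, I.3.7, Thm 9.
-/

noncomputable section

open Finset Filter
open scoped ArithmeticFunction.Moebius Topology

namespace Literature.NumberTheory.QuadraticFields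

/-- For `k ≥ 1`: `Σ_{i < N} 1/(i + k)² ≤ 2/k` (from Mathlib's `sum_Ioo_inv_sq_le`). [folklore] -/
theorem sum_range_inv_add_sq_le {k : ℕ} (hk : 1 ≤ k) (N : ℕ) :
    ∑ i ∈ range N, (((i + k : ℕ) : ℝ) ^ 2)⁻¹ ≤ (2 : ℝ) / k := by
  have h1 : ∑ i ∈ range N, (((i + k : ℕ) : ℝ) ^ 2)⁻¹ = ∑ j ∈ Ico k (k + N), ((j : ℝ) ^ 2)⁻¹ := by
    rw [Finset.sum_Ico_eq_sum_range, Nat.add_sub_cancel_left]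
    exact Finset.sum_congr rfl fun i _ => by rw [add_comm]
  have h2 : Ico k (k + N) ⊆ Ioo (k - 1) (k + N) := fun j hj => by
    rw [Finset.mem_Ico] at hj; rw [Finset.mem_Ioo]; omega
  calc ∑ i ∈ range N, (((i + k : ℕ) : ℝ) ^ 2)⁻¹ = ∑ j ∈ Ico k (k + N), ((j : ℝ) ^ 2)⁻¹ := h1
    _ ≤ ∑ j ∈ Ioo (k - 1) (k + N), ((j : ℝ) ^ 2)⁻¹ :=
        Finset.sum_le_sum_of_subset_of_nonneg h2 fun j _ _ => by positivity
    _ ≤ 2 / ((k - 1 : ℕ) + 1) := sum_Ioo_inv_sq_le (k - 1) (k + N)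
    _ = 2 / k := by
        have : ((k - 1 : ℕ) : ℝ) + 1 = ((k - 1 + 1 : ℕ) : ℝ) := by push_cast; ring
        rw [this, Nat.sub_add_cancel hk]

/-- **Tail bound, coprime weight**: for `L ≠ 0` and `k ≥ 1`,
`|(6/π²) Π_{p ∣ L} (1 - p⁻²)⁻¹ - Σ_{d < k, (d,L)=1} μ(d)/d²| ≤ 2/k`. [folklore] -/
theorem abs_sub_sum_range_moebius_coprime_div_sq_le {L : ℕ} (hL : L ≠ 0) {k : ℕ} (hk : 1 ≤ k) :
    |6 / Real.pi ^ 2 * (∏ p ∈ L.primeFactors, (1 - 1 / (p : ℝ) ^ 2)⁻¹)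
      - ∑ d ∈ range k, (if d.Coprime L then (μ d : ℝ) / (d : ℝ) ^ 2 else 0)| ≤ (2 : ℝ) / k := by
  set f : ℕ → ℝ := fun d => if d.Coprime L then (μ d : ℝ) / (d : ℝ) ^ 2 else 0 with hf
  have hS := hasSum_moebius_coprime_div_sq hL
  have htail := (hasSum_nat_add_iff' k).2 hS
  set g : ℕ → ℝ := fun n => (((n + k : ℕ) : ℝ) ^ 2)⁻¹ with hg
  have hg_summ : Summable g := by
    have h : Summable (fun n : ℕ => ((n : ℝ) ^ 2)⁻¹) := Real.summable_nat_pow_inv.mpr one_lt_two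
    exact (summable_nat_add_iff k).2 h
  have hbound : ∀ n, ‖f (n + k)‖ ≤ g n := by
    intro n
    simp only [hf, hg]
    split_ifs
    · rw [norm_div, norm_pow, Real.norm_natCast, Real.norm_eq_abs, ← Int.cast_abs, div_eq_mul_inv]
      have h1 : ((|μ (n + k)| : ℤ) : ℝ) ≤ 1 := by
        exact_mod_cast ArithmeticFunction.abs_moebius_le_one
      have h2 : 0 ≤ (((n + k : ℕ) : ℝ) ^ 2)⁻¹ := by positivity
      nlinarith
    · rw [norm_zero]; positivity
  have hle := htail.norm_le_of_bounded hg_summ.hasSum hbound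
  have hgle : ∑' n, g n ≤ 2 / k :=
    Real.tsum_le_of_sum_range_le (fun n => by positivity) fun N => sum_range_inv_add_sq_le hk N
  rw [Real.norm_eq_abs] at hle
  exact hle.trans hgle

/-! ### The multiplicative weight `d ↦ μ(d) 𝟙_{gcd(L,d²) ∣ c} gcd(L,d²)/d²` -/

/-- Multiplicativity of the gcd-weight: for coprime `m`, `n`,
`𝟙_{G_{mn} ∣ c} G_{mn}/(mn)² = (𝟙_{G_m ∣ c} G_m/m²)(𝟙_{G_n ∣ c} G_n/n²)`, `G_d = gcd(L, d²)`. [folklore] -/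
theorem gcdWeight_mul {L : ℕ} {c : ℤ} {m n : ℕ} (hmn : m.Coprime n) :
    (if ((Nat.gcd L ((m * n) ^ 2) : ℕ) : ℤ) ∣ c then
        ((Nat.gcd L ((m * n) ^ 2) : ℕ) : ℝ) / (((m * n : ℕ) : ℝ)) ^ 2 else 0) =
      (if ((Nat.gcd L (m ^ 2) : ℕ) : ℤ) ∣ c then ((Nat.gcd L (m ^ 2) : ℕ) : ℝ) / (m : ℝ) ^ 2
        else 0) *
      (if ((Nat.gcd L (n ^ 2) : ℕ) : ℤ) ∣ c then ((Nat.gcd L (n ^ 2) : ℕ) : ℝ) / (n : ℝ) ^ 2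
        else 0) := by
  have hmn2 : (m ^ 2).Coprime (n ^ 2) := Nat.Coprime.pow 2 2 hmn
  have hg : Nat.gcd L ((m * n) ^ 2) = Nat.gcd L (m ^ 2) * Nat.gcd L (n ^ 2) := by
    rw [mul_pow, Nat.Coprime.gcd_mul L hmn2]
  have hcop : (Nat.gcd L (m ^ 2)).Coprime (Nat.gcd L (n ^ 2)) := Nat.Coprime.gcd_both L L hmn2
  have hdvd : ((Nat.gcd L ((m * n) ^ 2) : ℕ) : ℤ) ∣ c ↔
      ((Nat.gcd L (m ^ 2) : ℕ) : ℤ) ∣ c ∧ ((Nat.gcd L (n ^ 2) : ℕ) : ℤ) ∣ c := by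
    rw [hg, Nat.cast_mul]
    refine ⟨fun h => ⟨(dvd_mul_right _ _).trans h, (dvd_mul_left _ _).trans h⟩, fun h => ?_⟩
    exact IsCoprime.mul_dvd (Nat.isCoprime_iff_coprime.2 hcop) h.1 h.2
  by_cases h1 : ((Nat.gcd L (m ^ 2) : ℕ) : ℤ) ∣ c
  · by_cases h2 : ((Nat.gcd L (n ^ 2) : ℕ) : ℤ) ∣ c
    · rw [if_pos (hdvd.2 ⟨h1, h2⟩), if_pos h1, if_pos h2, hg]
      push_cast
      rw [div_mul_div_comm, mul_pow]
    · rw [if_neg (fun h => h2 (hdvd.1 h).2), if_neg h2, mul_zero]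
  · rw [if_neg (fun h => h1 (hdvd.1 h).1), if_neg h1, zero_mul]

/-- The gcd-weight is bounded by `L/d²`. [folklore] -/
theorem gcdWeight_le {L : ℕ} (hL : 0 < L) (c : ℤ) (d : ℕ) :
    |(μ d : ℝ) * (if ((Nat.gcd L (d ^ 2) : ℕ) : ℤ) ∣ c then
        ((Nat.gcd L (d ^ 2) : ℕ) : ℝ) / (d : ℝ) ^ 2 else 0)| ≤ L / (d : ℝ) ^ 2 := by
  rw [abs_mul]
  have hμ : |((μ d : ℤ) : ℝ)| ≤ 1 := by
    rw [← Int.cast_abs]; exact_mod_cast ArithmeticFunction.abs_moebius_le_one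
  have hw : |(if ((Nat.gcd L (d ^ 2) : ℕ) : ℤ) ∣ c then
      ((Nat.gcd L (d ^ 2) : ℕ) : ℝ) / (d : ℝ) ^ 2 else 0)| ≤ L / (d : ℝ) ^ 2 := by
    split_ifs
    · rw [abs_of_nonneg (by positivity)]
      exact div_le_div_of_nonneg_right (by exact_mod_cast Nat.gcd_le_left _ hL) (by positivity)
    · rw [abs_zero]; positivity
  calc |((μ d : ℤ) : ℝ)| * _ ≤ 1 * (L / (d : ℝ) ^ 2) := mul_le_mul hμ hw (abs_nonneg _) zero_le_one
    _ = L / (d : ℝ) ^ 2 := one_mul _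

/-- The local factor of the gcd-weight at a prime `p`:
`Σ_e μ(pᵉ) w(pᵉ) = 1 - 𝟙_{G_p ∣ c} G_p/p²`. [folklore] -/
theorem tsum_moebius_gcdWeight_prime_pow {L : ℕ} (c : ℤ) {p : ℕ} (hp : p.Prime) :
    ∑' e : ℕ, (μ (p ^ e) : ℝ) * (if ((Nat.gcd L ((p ^ e) ^ 2) : ℕ) : ℤ) ∣ c then
        ((Nat.gcd L ((p ^ e) ^ 2) : ℕ) : ℝ) / (((p ^ e : ℕ) : ℝ)) ^ 2 else 0) =
      1 - (if ((Nat.gcd L (p ^ 2) : ℕ) : ℤ) ∣ c then ((Nat.gcd L (p ^ 2) : ℕ) : ℝ) / (p : ℝ) ^ 2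
        else 0) := by
  rw [tsum_eq_sum (s := {0, 1})]
  · rw [Finset.sum_pair (by norm_num)]
    simp only [pow_zero, ArithmeticFunction.moebius_apply_one, Int.cast_one, one_mul, pow_one,
      ArithmeticFunction.moebius_apply_prime hp, Int.cast_neg, neg_mul, one_pow, Nat.gcd_one_right,
      Nat.cast_one, one_dvd, if_true, div_one]
    ring
  · intro e he
    simp only [Finset.mem_insert, Finset.mem_singleton, not_or] at he
    have hμ : μ (p ^ e) = 0 := by
      rw [ArithmeticFunction.moebius_apply_prime_pow hp he.1, if_neg he.2]
    simp [hμ]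

/-- **The density series**: for `L ≥ 1` and any `c`,
`Σ_d μ(d) 𝟙_{gcd(L,d²) ∣ c} gcd(L,d²)/d² = (6/π²) Π_{p ∣ L} (1 - 𝟙_{G_p ∣ c} G_p/p²)(1 - p⁻²)⁻¹`
(`G_p = gcd(L, p²)`). [folklore] -/
theorem hasSum_moebius_gcdWeight {L : ℕ} (hL : 0 < L) (c : ℤ) :
    HasSum (fun d : ℕ => (μ d : ℝ) * (if ((Nat.gcd L (d ^ 2) : ℕ) : ℤ) ∣ c then
        ((Nat.gcd L (d ^ 2) : ℕ) : ℝ) / (d : ℝ) ^ 2 else 0))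
      (6 / Real.pi ^ 2 * ∏ p ∈ L.primeFactors,
        (1 - (if ((Nat.gcd L (p ^ 2) : ℕ) : ℤ) ∣ c then ((Nat.gcd L (p ^ 2) : ℕ) : ℝ) / (p : ℝ) ^ 2
          else 0)) * (1 - 1 / (p : ℝ) ^ 2)⁻¹) := by
  set f : ℕ → ℝ := fun d => (μ d : ℝ) * (if ((Nat.gcd L (d ^ 2) : ℕ) : ℤ) ∣ c then
        ((Nat.gcd L (d ^ 2) : ℕ) : ℝ) / (d : ℝ) ^ 2 else 0) with hf
  set e : ℕ → ℝ := fun p => 1 - (if ((Nat.gcd L (p ^ 2) : ℕ) : ℤ) ∣ c then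
      ((Nat.gcd L (p ^ 2) : ℕ) : ℝ) / (p : ℝ) ^ 2 else 0) with he
  have hf1 : f 1 = 1 := by simp [hf]
  have hf0 : f 0 = 0 := by simp [hf]
  have hmul : ∀ {m n : ℕ}, Nat.Coprime m n → f (m * n) = f m * f n := by
    intro m n hmn
    simp only [hf]
    rw [ArithmeticFunction.isMultiplicative_moebius.map_mul_of_coprime hmn, gcdWeight_mul hmn]
    push_cast
    ring
  have hsum : Summable (fun d : ℕ => ‖f d‖) := by
    refine Summable.of_nonneg_of_le (fun _ => norm_nonneg _) (fun d => ?_)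
      ((Real.summable_one_div_nat_pow.mpr one_lt_two).mul_left (L : ℝ))
    rw [Real.norm_eq_abs]
    refine (gcdWeight_le hL c d).trans (le_of_eq ?_)
    rw [mul_one_div]
  -- Euler product of `f`, indexed by `ℕ` with the indicator of the primes
  have hA := EulerProduct.eulerProduct_hasProd_mulIndicator hf1 hmul hsum hf0
  have hfun : ({p : ℕ | p.Prime}.mulIndicator fun n : ℕ => ∑' k : ℕ, f (n ^ k)) =
      {p : ℕ | p.Prime}.mulIndicator e := by
    ext n
    by_cases hn : n ∈ {p : ℕ | p.Prime}
    · rw [Set.mulIndicator_of_mem hn, Set.mulIndicator_of_mem hn, he]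
      exact tsum_moebius_gcdWeight_prime_pow c hn
    · rw [Set.mulIndicator_of_notMem hn, Set.mulIndicator_of_notMem hn]
  rw [hfun] at hA
  -- `e p = 1 - p⁻²` for primes not dividing `L`
  have he_of_not_dvd : ∀ p : ℕ, p.Prime → ¬ p ∣ L → e p = 1 - 1 / (p : ℝ) ^ 2 := by
    intro p hp hpL
    have hg : Nat.gcd L (p ^ 2) = 1 := by
      have : Nat.Coprime L p := (hp.coprime_iff_not_dvd.2 hpL).symm
      exact Nat.Coprime.pow_right 2 this
    simp [he, hg]
  -- the finitely supported correction factor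
  set B : ℕ → ℝ := fun n => if n ∈ L.primeFactors then e n * (1 - 1 / (n : ℝ) ^ 2)⁻¹ else 1
    with hB
  have hBT : ∀ n ∉ L.primeFactors, B n = 1 := fun n hn => by rw [hB]; dsimp only; rw [if_neg hn]
  have hBprod : HasProd B (∏ n ∈ L.primeFactors, B n) := hasProd_prod_of_ne_finset_one hBT
  have hTprod : ∏ n ∈ L.primeFactors, B n =
      ∏ p ∈ L.primeFactors, e p * (1 - 1 / (p : ℝ) ^ 2)⁻¹ :=
    Finset.prod_congr rfl fun n hn => by rw [hB]; dsimp only; rw [if_pos hn]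
  rw [hTprod] at hBprod
  -- `ζ(2)⁻¹`-product times the correction equals the Euler product of `f`
  have hZB := hasProd_mulIndicator_one_sub_one_div_sq.mul hBprod
  have hZBfun : (fun n : ℕ => {p : ℕ | p.Prime}.mulIndicator (fun n : ℕ => (1 - 1 / (n : ℝ) ^ 2)) n
      * B n) = {p : ℕ | p.Prime}.mulIndicator e := by
    ext n
    by_cases hn : n ∈ {p : ℕ | p.Prime}
    · have hp : n.Prime := hn
      rw [Set.mulIndicator_of_mem hn, Set.mulIndicator_of_mem hn, hB]
      dsimp only
      by_cases hd : n ∣ L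
      · have hmem : n ∈ L.primeFactors := Nat.mem_primeFactors.2 ⟨hp, hd, hL.ne'⟩
        rw [if_pos hmem]
        have hne : (1 - 1 / (n : ℝ) ^ 2) ≠ 0 := by
          have hn2 : (2 : ℝ) ≤ n := by exact_mod_cast hp.two_le
          have : 1 / (n : ℝ) ^ 2 ≤ 1 / 4 := one_div_le_one_div_of_le (by norm_num) (by nlinarith)
          linarith
        field_simp
      · have hmem : n ∉ L.primeFactors := fun h => hd (Nat.dvd_of_mem_primeFactors h)
        rw [if_neg hmem, mul_one, he_of_not_dvd n hp hd]
    · have hmem : n ∉ L.primeFactors := fun h => hn (Nat.prime_of_mem_primeFactors h)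
      rw [Set.mulIndicator_of_notMem hn, Set.mulIndicator_of_notMem hn, hB]
      dsimp only
      rw [if_neg hmem, mul_one]
  rw [hZBfun] at hZB
  have hval := hA.unique hZB
  rw [← hval]
  exact hsum.of_norm.hasSum

/-- For `k ≥ 1`: `Σ_{i < N} L/(i + k)² ≤ 2L/k`. [folklore] -/
theorem sum_range_const_div_add_sq_le (L : ℝ) (hL : 0 ≤ L) {k : ℕ} (hk : 1 ≤ k) (N : ℕ) :
    ∑ i ∈ range N, L / (((i + k : ℕ) : ℝ) ^ 2) ≤ 2 * L / k := by
  have h := sum_range_inv_add_sq_le hk N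
  calc ∑ i ∈ range N, L / (((i + k : ℕ) : ℝ) ^ 2)
      = L * ∑ i ∈ range N, (((i + k : ℕ) : ℝ) ^ 2)⁻¹ := by
        rw [Finset.mul_sum]; exact Finset.sum_congr rfl fun i _ => by rw [div_eq_mul_inv]
    _ ≤ L * ((2 : ℝ) / k) := mul_le_mul_of_nonneg_left h hL
    _ = 2 * L / k := by ring

/-- **Tail bound**: for `L ≥ 1`, any `c` and `k ≥ 1`, the density series beyond `d < k` is at
most `2L/k` in absolute value. [folklore] -/
theorem abs_sub_sum_range_moebius_gcdWeight_le {L : ℕ} (hL : 0 < L) (c : ℤ) {k : ℕ}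
    (hk : 1 ≤ k) :
    |6 / Real.pi ^ 2 * (∏ p ∈ L.primeFactors,
        (1 - (if ((Nat.gcd L (p ^ 2) : ℕ) : ℤ) ∣ c then ((Nat.gcd L (p ^ 2) : ℕ) : ℝ) / (p : ℝ) ^ 2
          else 0)) * (1 - 1 / (p : ℝ) ^ 2)⁻¹)
      - ∑ d ∈ range k, (μ d : ℝ) * (if ((Nat.gcd L (d ^ 2) : ℕ) : ℤ) ∣ c then
        ((Nat.gcd L (d ^ 2) : ℕ) : ℝ) / (d : ℝ) ^ 2 else 0)| ≤ (2 : ℝ) * L / k := by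
  set f : ℕ → ℝ := fun d => (μ d : ℝ) * (if ((Nat.gcd L (d ^ 2) : ℕ) : ℤ) ∣ c then
        ((Nat.gcd L (d ^ 2) : ℕ) : ℝ) / (d : ℝ) ^ 2 else 0) with hf
  have hS := hasSum_moebius_gcdWeight hL c
  have htail := (hasSum_nat_add_iff' k).2 hS
  set g : ℕ → ℝ := fun n => L / (((n + k : ℕ) : ℝ) ^ 2) with hg
  have hg_summ : Summable g := by
    have h : Summable (fun n : ℕ => (L : ℝ) * (1 / (n : ℝ) ^ 2)) :=
      (Real.summable_one_div_nat_pow.mpr one_lt_two).mul_left (L : ℝ)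
    have h' := (summable_nat_add_iff k).2 h
    refine h'.congr fun n => ?_
    simp only [hg, mul_one_div]
  have hbound : ∀ n, ‖f (n + k)‖ ≤ g n := fun n => by
    rw [Real.norm_eq_abs]; exact gcdWeight_le hL c (n + k)
  have hle := htail.norm_le_of_bounded hg_summ.hasSum hbound
  have hgle : ∑' n, g n ≤ 2 * L / k :=
    Real.tsum_le_of_sum_range_le (fun n => by positivity)
      fun N => sum_range_const_div_add_sq_le L (Nat.cast_nonneg L) hk N
  rw [Real.norm_eq_abs] at hle
  exact hle.trans hgle

end Literature.NumberTheory.QuadraticFields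

end
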